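import Summits.AtomisticToContinuum.FouriersLaw.Theorems.VanishingNoiseTransferNoiseLocalityStubNoisyPositiveAux1
import Summits.AtomisticToContinuum.FouriersLaw.Theorems.VanishingNoiseTransferNoiseLocalityStubNoisyPositiveAux3
import Literature.MathematicalPhysics.KineticTheory.VelocityFlipNoise

/-!
# Stub `stub_noisyPositive` of crux `NoiseLocality` (line `relative-flip-energy-transfer`):
the linear-response coefficient of the velocity-flip noisy chain is strictly positive

File `--supports stmt-AtomisticToContinuum-11975` (crux `NoiseLocality`, route `VanishingNoiseTransfer`),
registered stub `stub_noisyPositive` of the skeleton `relative_flip_energy_transfer` (v3).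

**Theorem (`stub_noisyPositive`).** Pinned anharmonic chain `pinnedChain ω₂ lam β γ` (all parameters `> 0`)
between Langevin baths, `T > 0`, `N ≥ 2`, flip rate `ε > 0`, the unique weak steady family `μ` of `L + εS`
(`S f = ∑_i (f∘Θ_i - f)`), a response density `U ∈ L²(μ_T)` of the family at `T` (`HasDerivAt` clauses on
test functions and on the total current) and the response coefficient `D` (limit of `totalCurrent/δ`
along `𝓝[≠] 0`). Then `0 < D`.

Proof. `μ_{T,T} = μ_T` (Gibbs), `D = ∫ J U dμ_T` and `U` solves the weak adjoint equation
`∫ (L F + ε S F) U dμ_T = -∫ F φ̃ dμ_T` (`φ̃ = γ(p_0² - p_{N-1}²)/(2T²)`, `F ∈ C_c^∞`). By the flip dissipation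
bound (stub 3, `StubFlipDissipationBound.le_of_weak`) `ε(N-1)T² 𝓔_f(U) ≤ D` with the flip energy
`𝓔_f(U) = ½∑_i ∫ (U - U∘Θ_i)² dμ_T`. If `D ≤ 0`, then `𝓔_f(U) = 0`: `U` is invariant under every velocity flip,
`S U = 0`, and `U` solves the DETERMINISTIC weak adjoint equation `∫ (L F) U dμ_T = -∫ F φ̃ dμ_T`; moreover
`U∘Θ = U` a.e. for the momentum reversal `Θ`. Such a `U` does not exist
(`StubNoisyPositive.false_of_flipInvariant_weak`): by hypoellipticity (Hörmander, part 1) `U` has a smooth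
representative, even in `p`, solving `L† U = -φ̃` pointwise; evenness and `L† = ΘLΘ` split this into
`{H,U} = 0` and `B U = -φ̃/γ` for the two Ornstein–Uhlenbeck taps `B`; the `L²`-kernel of `B` (part 2,
a Caccioppoli argument) pins down `∂_{p_0}U = p_0/(2T²)`, `∂_{p_{N-1}}U = -p_{N-1}/(2T²)`, and then
`U - H/(2T²)` is a `C²` first integral of the closed chain blind to `p_0`, hence constant by the
first-integral rigidity of the pinned chain (`poisson_hamiltonian_rigidity`, `V'' > 0`) — contradicting
`∂_{p_{N-1}}(U - H/(2T²)) = -p_{N-1}/T²` (part 3). Hence `D > 0`. No definitions.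
-/

noncomputable section

open MeasureTheory Filter Topology
open scoped ContDiff

namespace Summit.AtomisticToContinuum.FouriersLaw.Theorems.NoiseLocality

open Literature.MathematicalPhysics.KineticTheory.HeatConduction
open Summit.AtomisticToContinuum.FouriersLaw.Theorems.OddSectorIrreversibility
open Summit.AtomisticToContinuum.FouriersLaw.Theorems.NoiseLocality.StubResponseDensityNoisy
open Summit.AtomisticToContinuum.FouriersLaw.Theorems.NoiseLocality.StubDuhamelFlipBound

namespace StubNoisyPositive

variable {ω₂ lam β γ : ℝ} {N : ℕ} {T : ℝ}

/-- **No flip-invariant deterministic response density.** For the pinned chain (`ω₂ > 0`, `lam, β ≥ 0`,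
`γ > 0`, `N ≥ 2`, `T > 0`) there is no `U ∈ L²(μ_T)`, invariant a.e. under every velocity flip `Θ_i`, solving
the deterministic weak adjoint equation `∫ (L_{T,T} F) U dμ_T = -∫ F φ̃ dμ_T` (`F ∈ C_c^∞`,
`φ̃ = γ(p_0² - p_{N-1}²)/(2T²)`): a measurable modification is a.e. equal to a smooth function (hypoelliptic
regularity, `exists_contDiff_ae_eq_of_weak_inhom`), which is `Θ`-even everywhere, square-integrable, and
solves `(L(U∘Θ))∘Θ = -φ̃` pointwise (`adjoint_eq_of_weak`) — impossible by
`false_of_contDiff_even_adjoint_solution`. -/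
theorem false_of_flipInvariant_weak (hω : 0 < ω₂) (hl : 0 ≤ lam) (hβ : 0 ≤ β) (hγ : 0 < γ) (hN : 2 ≤ N)
    (hT : 0 < T) {U : PhaseSpace N → ℝ} (hUm : MemLp U 2 ((pinnedChain ω₂ lam β γ).gibbsMeasure N T))
    (hflip : ∀ i : Fin N,
      (fun x => U (momentumFlip i x)) =ᵐ[(pinnedChain ω₂ lam β γ).gibbsMeasure N T] U)
    (hweak : ∀ F : PhaseSpace N → ℝ, ContDiff ℝ ∞ F → HasCompactSupport F →
      ∫ x, (pinnedChain ω₂ lam β γ).generator N T T F x * U x ∂((pinnedChain ω₂ lam β γ).gibbsMeasure N T) =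
        -∫ x, F x * (γ / (2 * T ^ 2) * (x.2 ⟨0, by omega⟩ ^ 2 - x.2 ⟨N - 1, by omega⟩ ^ 2))
          ∂((pinnedChain ω₂ lam β γ).gibbsMeasure N T)) : False := by
  set P := pinnedChain ω₂ lam β γ with hP
  set π := P.gibbsMeasure N T with hπ_def
  haveI : IsProbabilityMeasure π := pinnedChain_isProbabilityMeasure_gibbsMeasure hω hl hβ γ N hT
  have hΘi : ∀ i : Fin N, MeasurePreserving (momentumFlip i) π π := fun i =>
    P.measurePreserving_momentumFlip_gibbsMeasure N T i
  have hΘ : MeasurePreserving (momentumReversal N) π π :=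
    OddResponseBound.DensityUnique.measurePreserving_momentumReversal_gibbsMeasure P N T
  set φ : PhaseSpace N → ℝ := fun x =>
    γ / (2 * T ^ 2) * (x.2 ⟨0, by omega⟩ ^ 2 - x.2 ⟨N - 1, by omega⟩ ^ 2) with hφ
  have hφs : ContDiff ℝ ∞ fun x => -φ x := by
    simp only [hφ]
    fun_prop
  -- a measurable modification `k` of `U`
  set k : PhaseSpace N → ℝ := hUm.aestronglyMeasurable.aemeasurable.mk U with hk
  have hkm : Measurable k := hUm.aestronglyMeasurable.aemeasurable.measurable_mk
  have hUk : U =ᵐ[π] k := hUm.aestronglyMeasurable.aemeasurable.ae_eq_mk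
  have hki : Integrable k π := (hUm.integrable one_le_two).congr hUk
  have hweak_k : ∀ F : PhaseSpace N → ℝ, ContDiff ℝ ∞ F → HasCompactSupport F →
      ∫ x, P.generator N T T F x * k x ∂π = ∫ x, F x * (-φ x) ∂π := by
    intro F hF hFc
    have e1 : ∫ x, P.generator N T T F x * k x ∂π = ∫ x, P.generator N T T F x * U x ∂π :=
      integral_congr_ae (by filter_upwards [hUk] with x hx; rw [hx])
    rw [e1, hweak F hF hFc, ← integral_neg]
    exact integral_congr_ae (Eventually.of_forall fun x => by simp only [hφ]; ring)
  -- hypoelliptic regularity: a smooth representative `g`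
  obtain ⟨g, hgs, -, hkg⟩ :=
    exists_contDiff_ae_eq_of_weak_inhom hω hl hβ hγ (by omega) hT hφs hkm hki hweak_k
  have hUg : U =ᵐ[π] g := hUk.trans hkg
  have hg2 : ContDiff ℝ 2 g := hgs.of_le (by norm_cast)
  have hgm : MemLp g 2 π := hUm.ae_eq hUg
  -- `g` is `Θ`-even everywhere
  have hvol : (volume : Measure (PhaseSpace N)) ≪ π := by
    rw [hπ_def, P.gibbsMeasure_eq]
    exact absolutelyContinuous_tilted (pinnedChain_integrable_gibbsDensity hω hl hβ γ N hT)
  have hUΘ : (fun x : PhaseSpace N => U (x.1, -x.2)) =ᵐ[π] U := ae_eq_comp_reversal_of_flips hΘi hflip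
  have hgΘ : (fun x : PhaseSpace N => g (x.1, -x.2)) =ᵐ[π] g := by
    have h1 : (fun x : PhaseSpace N => U (x.1, -x.2)) =ᵐ[π] fun x : PhaseSpace N => g (x.1, -x.2) :=
      hΘ.quasiMeasurePreserving.ae_eq_comp hUg
    exact (h1.symm.trans hUΘ).trans hUg
  have heven : ∀ x : PhaseSpace N, g (x.1, -x.2) = g x := by
    have hc : Continuous fun x : PhaseSpace N => g (x.1, -x.2) :=
      hgs.continuous.comp (continuous_fst.prodMk continuous_snd.neg)
    have heq := (Continuous.ae_eq_iff_eq volume hc hgs.continuous).1 (hvol.ae_eq hgΘ)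
    exact fun x => congrFun heq x
  -- `g ∈ L²(e^{-H/T} dx)`
  have hg2i : Integrable (fun x => g x ^ 2 * P.gibbsDensity N T x) :=
    (integrable_mul_gibbsDensity_iff hω hl hβ γ N hT (fun x => g x ^ 2)).2 hgm.integrable_sq
  -- the weak equation for `g`, and its pointwise form
  have hweak_g : ∀ F : PhaseSpace N → ℝ, ContDiff ℝ ∞ F → HasCompactSupport F →
      ∫ x, P.generator N T T F x * g x ∂π = ∫ x, F x * (-φ x) ∂π := by
    intro F hF hFc
    have e1 : ∫ x, P.generator N T T F x * g x ∂π = ∫ x, P.generator N T T F x * k x ∂π :=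
      integral_congr_ae (by filter_upwards [hkg] with x hx; rw [hx])
    rw [e1]
    exact hweak_k F hF hFc
  have hadj : ∀ x : PhaseSpace N,
      P.generator N T T (fun y : PhaseSpace N => g (y.1, -y.2)) (x.1, -x.2) = -φ x := fun x =>
    adjoint_eq_of_weak hω hl hβ hT (f := fun x => -φ x) hφs.continuous hg2 hweak_g x
  exact false_of_contDiff_even_adjoint_solution hω hl hβ hγ hN hT hg2 heven hg2i hadj

/-- **Strict positivity of the pairing `∫ J U dμ_T`, main case `N ≥ 2`.** If `U ∈ L²(μ_T)` solves the weak
adjoint equation of the flip-noisy chain at rate `ε > 0`, `∫ (L F + ε S F) U dμ_T = -∫ F φ̃ dμ_T` for all test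
`F`, then `0 < ∫ J U dμ_T` (`J = ∑_i j_i`): otherwise the flip dissipation bound `ε(N-1)T² 𝓔_f(U) ≤ ∫ J U`
(`StubFlipDissipationBound.le_of_weak`) forces `𝓔_f(U) = 0`, i.e. `U` flip-invariant, the noise drops out of
the weak equation, and `false_of_flipInvariant_weak` applies. -/
theorem integral_totalCurrent_mul_pos_of_weak (hω : 0 < ω₂) (hl : 0 ≤ lam) (hβ : 0 < β) (hγ : 0 < γ)
    (hN : 2 ≤ N) (hT : 0 < T) {ε : ℝ} (hε : 0 < ε) {U : PhaseSpace N → ℝ}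
    (hUm : MemLp U 2 ((pinnedChain ω₂ lam β γ).gibbsMeasure N T))
    (hE : ∀ F : PhaseSpace N → ℝ, ContDiff ℝ ∞ F → HasCompactSupport F →
      ∫ x, (pinnedChain ω₂ lam β γ).flipGenerator N T T ε F x * U x
          ∂((pinnedChain ω₂ lam β γ).gibbsMeasure N T) =
        -∫ x, F x * (γ / (2 * T ^ 2) * (x.2 ⟨0, by omega⟩ ^ 2 - x.2 ⟨N - 1, by omega⟩ ^ 2))
          ∂((pinnedChain ω₂ lam β γ).gibbsMeasure N T)) :
    0 < ∫ x, (∑ i : Fin N, (pinnedChain ω₂ lam β γ).bondCurrent N i x) * U x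
      ∂((pinnedChain ω₂ lam β γ).gibbsMeasure N T) := by
  set P := pinnedChain ω₂ lam β γ with hP
  set π := P.gibbsMeasure N T with hπ_def
  haveI : IsProbabilityMeasure π := pinnedChain_isProbabilityMeasure_gibbsMeasure hω hl hβ.le γ N hT
  have hΘi : ∀ i : Fin N, MeasurePreserving (momentumFlip i) π π := fun i =>
    P.measurePreserving_momentumFlip_gibbsMeasure N T i
  by_contra hD
  push Not at hD
  -- the flip dissipation bound forces zero flip energy
  have hle := StubFlipDissipationBound.le_of_weak hω hl hβ hγ hN hT ε hUm hE
  set E : Fin N → ℝ := fun i => ∫ x, (U x - U (momentumFlip i x)) ^ 2 ∂π with hEdef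
  have hE0 : ∀ i, 0 ≤ E i := fun i => integral_nonneg fun x => sq_nonneg _
  have hc : 0 < ε * ((N : ℝ) - 1) * T ^ 2 := by
    have h2 : (2 : ℝ) ≤ N := by exact_mod_cast hN
    have h1 : 0 < (N : ℝ) - 1 := by linarith
    positivity
  have hsum0 : ∑ i, E i ≤ 0 := by
    by_contra hpos
    push Not at hpos
    have : 0 < ε * ((N : ℝ) - 1) * T ^ 2 * ((1 / 2) * ∑ i, E i) := by positivity
    linarith
  have hEi : ∀ i, E i = 0 := fun i =>
    le_antisymm ((Finset.single_le_sum (fun j _ => hE0 j) (Finset.mem_univ i)).trans hsum0) (hE0 i)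
  -- hence `U` is invariant under every flip
  have hflip : ∀ i : Fin N, (fun x => U (momentumFlip i x)) =ᵐ[π] U := by
    intro i
    have hdiff : MemLp (fun x => U x - U (momentumFlip i x)) 2 π := hUm.sub (hUm.comp_measurePreserving (hΘi i))
    have hsq : (fun x => (U x - U (momentumFlip i x)) ^ 2) =ᵐ[π] 0 :=
      (integral_eq_zero_iff_of_nonneg (fun x => sq_nonneg _) hdiff.integrable_sq).1 (hEi i)
    filter_upwards [hsq] with x hx
    have hx' : (U x - U (momentumFlip i x)) ^ 2 = 0 := hx
    exact (sub_eq_zero.1 (pow_eq_zero_iff (n := 2) two_ne_zero |>.1 hx')).symm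
  -- the noise drops out of the weak equation
  have hSU : flipNoise N U =ᵐ[π] 0 := by
    have hall : ∀ᵐ x ∂π, ∀ i : Fin N, U (momentumFlip i x) = U x :=
      ae_all_iff.2 fun i => hflip i
    filter_upwards [hall] with x hx
    simp only [flipNoise_eq, hx, sub_self, Finset.sum_const_zero, Pi.zero_apply]
  have hweak : ∀ F : PhaseSpace N → ℝ, ContDiff ℝ ∞ F → HasCompactSupport F →
      ∫ x, P.generator N T T F x * U x ∂π =
        -∫ x, F x * (γ / (2 * T ^ 2) * (x.2 ⟨0, by omega⟩ ^ 2 - x.2 ⟨N - 1, by omega⟩ ^ 2)) ∂π := by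
    intro F hF hFc
    have hF2 : ContDiff ℝ 2 F := hF.of_le (by norm_cast)
    have hFm : MemLp F 2 π := memLp_of_continuous_hasCompactSupport hF.continuous hFc π 2
    have hLm : MemLp (P.generator N T T F) 2 π :=
      memLp_of_continuous_hasCompactSupport
        (P.continuous_generator (pinnedChain_contDiff_U ω₂ lam β γ) (pinnedChain_contDiff_V ω₂ lam β γ)
          N T T hF2) (P.hasCompactSupport_generator N T T hF2 hFc) π 2
    have iFU : Integrable (fun x => F x * U x) π := hFm.integrable_mul hUm
    have iLU : Integrable (fun x => P.generator N T T F x * U x) π := hLm.integrable_mul hUm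
    have iSU : Integrable (fun x => flipNoise N F x * U x) π := (memLp_flipNoise hΘi hFm).integrable_mul hUm
    have h0 := hE F hF hFc
    have hsplit : ∫ x, P.flipGenerator N T T ε F x * U x ∂π =
        (∫ x, P.generator N T T F x * U x ∂π) + ε * ∫ x, flipNoise N F x * U x ∂π := by
      rw [← integral_const_mul, ← integral_add iLU (iSU.const_mul ε)]
      exact integral_congr_ae (Eventually.of_forall fun x => by
        simp only [OscillatorChain.flipGenerator_eq_add_flipNoise]
        ring)
    have hsym : ∫ x, flipNoise N F x * U x ∂π = 0 := by
      rw [← integral_mul_flipNoise hΘi iFU fun i => hFm.integrable_mul (hUm.comp_measurePreserving (hΘi i))]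
      have e : (fun x => F x * flipNoise N U x) =ᵐ[π] fun _ => 0 := by
        filter_upwards [hSU] with x hx
        rw [hx, Pi.zero_apply, mul_zero]
      rw [integral_congr_ae e, integral_zero]
    rw [hsplit, hsym, mul_zero, add_zero] at h0
    exact h0
  exact false_of_flipInvariant_weak hω hl hβ.le hγ hN hT hUm hflip hweak

end StubNoisyPositive

/-- **Registered stub `stub_noisyPositive` of crux `NoiseLocality` (line `relative-flip-energy-transfer`,
skeleton v3).** For the pinned anharmonic chain (all parameters `> 0`), `T > 0`, `N ≥ 2`, any flip rate
`ε > 0`, the unique weak steady family `μ` of `L + εS`, ANY response density `U` of the family at `T`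
(square-integrable for the Gibbs measure, representing the `δ`-derivatives at `0` of `∫ g dμ_{T+δ/2,T-δ/2}` for
test `g` and of the total current) and the response coefficient `D` (limit of `totalCurrent/δ` along
`𝓝[≠] 0`): `0 < D`. See the module docstring: `D = ∫ J U dμ_T`, the weak adjoint equation, the flip
dissipation bound, and the non-existence of flip-invariant deterministic response densities (hypoelliptic
regularity, the `L²`-kernel of the Ornstein–Uhlenbeck taps, first-integral rigidity of the closed chain). -/
theorem stub_noisyPositive :
    ∀ ω₂ lam β γ : ℝ, 0 < ω₂ → 0 < lam → 0 < β → 0 < γ → ∀ T : ℝ, 0 < T →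
    ∀ N : ℕ, 2 ≤ N → ∀ ε : ℝ, 0 < ε →
    ∀ μ : ℝ → ℝ → MeasureTheory.Measure (Literature.MathematicalPhysics.KineticTheory.HeatConduction.PhaseSpace N),
    (∀ T_L T_R : ℝ, 0 < T_L → 0 < T_R →
      (Literature.MathematicalPhysics.KineticTheory.HeatConduction.pinnedChain ω₂ lam β γ).IsFlipSteadyState N T_L T_R ε
          (μ T_L T_R) ∧
        ∀ ν : MeasureTheory.Measure (Literature.MathematicalPhysics.KineticTheory.HeatConduction.PhaseSpace N),
          (Literature.MathematicalPhysics.KineticTheory.HeatConduction.pinnedChain ω₂ lam β γ).IsFlipSteadyState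
              N T_L T_R ε ν → ν = μ T_L T_R) →
    ∀ U : Literature.MathematicalPhysics.KineticTheory.HeatConduction.PhaseSpace N → ℝ,
    (MeasureTheory.MemLp U 2
          ((Literature.MathematicalPhysics.KineticTheory.HeatConduction.pinnedChain ω₂ lam β γ).gibbsMeasure N T) ∧
        (∀ g : Literature.MathematicalPhysics.KineticTheory.HeatConduction.PhaseSpace N → ℝ,
          ContDiff ℝ ((⊤ : ℕ∞) : WithTop ℕ∞) g → HasCompactSupport g →
            HasDerivAt (fun δ : ℝ => ∫ x, g x ∂(μ (T + δ / 2) (T - δ / 2)))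
              (∫ x, g x * U x
                ∂((Literature.MathematicalPhysics.KineticTheory.HeatConduction.pinnedChain ω₂ lam β γ).gibbsMeasure N T))
              0) ∧
        HasDerivAt (fun δ : ℝ =>
            (Literature.MathematicalPhysics.KineticTheory.HeatConduction.pinnedChain ω₂ lam β γ).totalCurrent
              (μ (T + δ / 2) (T - δ / 2)))
          (∑ i : Fin N, ∫ x,
            (Literature.MathematicalPhysics.KineticTheory.HeatConduction.pinnedChain ω₂ lam β γ).bondCurrent N i x * U x
              ∂((Literature.MathematicalPhysics.KineticTheory.HeatConduction.pinnedChain ω₂ lam β γ).gibbsMeasure N T))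
          0) →
    ∀ D : ℝ,
    Filter.Tendsto (fun δ : ℝ =>
        (Literature.MathematicalPhysics.KineticTheory.HeatConduction.pinnedChain ω₂ lam β γ).totalCurrent
          (μ (T + δ / 2) (T - δ / 2)) / δ) (nhdsWithin 0 {(0 : ℝ)}ᶜ) (nhds D) →
    0 < D := by
  intro ω₂ lam β γ hω hl hβ hγ T hT N hN ε hε μ hμ U hU D hD
  obtain ⟨hUm, hUg, hUJ⟩ := hU
  -- the diagonal member is the Gibbs measure
  have hπε : μ T T = (pinnedChain ω₂ lam β γ).gibbsMeasure N T :=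
    flipSteadyFamily_eq_gibbsMeasure hω hl.le hβ.le γ hT ε μ hμ
  -- the response coefficient as a pairing with the total current
  have hD' := responseCoeff_eq μ hπε hUJ hD
  haveI : IsProbabilityMeasure ((pinnedChain ω₂ lam β γ).gibbsMeasure N T) :=
    pinnedChain_isProbabilityMeasure_gibbsMeasure hω hl.le hβ.le γ N hT
  -- the weak adjoint equation
  have hEε : ∀ F : PhaseSpace N → ℝ, ContDiff ℝ ∞ F → HasCompactSupport F →
      ∫ x, (pinnedChain ω₂ lam β γ).flipGenerator N T T ε F x * U x
          ∂((pinnedChain ω₂ lam β γ).gibbsMeasure N T) =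
        -∫ x, F x * (γ / (2 * T ^ 2) * (x.2 ⟨0, by omega⟩ ^ 2 - x.2 ⟨N - 1, by omega⟩ ^ 2))
          ∂((pinnedChain ω₂ lam β γ).gibbsMeasure N T) := fun F hF hFc =>
    integral_flipGenerator_mul_responseDensity_gibbs hω hl.le hβ.le hN hT ε μ
      (fun T_L T_R hL hR => (hμ T_L T_R hL hR).1) hπε hUg hF hFc
  -- `D = ∫ J U dμ_T > 0`
  have hsum : ∑ i : Fin N, ∫ x, (pinnedChain ω₂ lam β γ).bondCurrent N i x * U x
        ∂((pinnedChain ω₂ lam β γ).gibbsMeasure N T) =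
      ∫ x, (∑ i : Fin N, (pinnedChain ω₂ lam β γ).bondCurrent N i x) * U x
        ∂((pinnedChain ω₂ lam β γ).gibbsMeasure N T) := by
    have hi : ∀ i : Fin N, Integrable (fun x => (pinnedChain ω₂ lam β γ).bondCurrent N i x * U x)
        ((pinnedChain ω₂ lam β γ).gibbsMeasure N T) := fun i =>
      (memLp_bondCurrent_gibbsMeasure hω hl.le hβ.le γ N hT i).integrable_mul hUm
    rw [← integral_finsetSum _ fun i _ => hi i]
    exact integral_congr_ae (Eventually.of_forall fun x => by simp only [Finset.sum_mul])
  rw [hD', hsum]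
  exact StubNoisyPositive.integral_totalCurrent_mul_pos_of_weak hω hl.le hβ hγ hN hT hε hUm hEε

end Summit.AtomisticToContinuum.FouriersLaw.Theorems.NoiseLocality

end
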